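import Literature.NumberTheory.DiophantineGeometry.GenEllTorsionFieldBaseChange
import Literature.NumberTheory.DiophantineGeometry.GenEllLCyclic
import Literature.NumberTheory.EllipticCurves.AdditiveReductionRamifiedTorsionProofs
import Literature.NumberTheory.EllipticCurves.DivisionFieldDegreeProofs
import Literature.NumberTheory.EllipticCurves.GaloisActionProofs
import Literature.NumberTheory.GaloisRepresentations.ArtinRestriction
import HarnessLib

/-!
# [GenEll] Thm 3.8, proof, first step: the field `L′ = L(E[15])`, `[L′:L] ∣ 23040`, over which
# `E` becomes semistable

S. Mochizuki, *Arithmetic elliptic curves in general position*, Math. J. Okayama Univ. **52** (2010)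
[cite: MochizukiGenEll2010], proof of Theorem 3.8, p. 20:

> First, let us observe that for an `E_L` as in the statement of Theorem 3.8, there exists a Galois
> extension `L′` of `L` of degree that divides `d₀ := (3² − 1)(3² − 3)(5² − 1)(5² − 5) = 23040` [i.e.,
> the order of `GL₂(𝔽₃) × GL₂(𝔽₅)`], so as to render the `3`- and `5`-torsion points of `E_L` rational
> over `L′` [which has the effect of eliminating automorphisms of elliptic curves in all
> characteristics], we may assume that `E_{L′} := E_L ×_L L′` has semi-stable reduction at all of
> the finite primes of `L` [sic].

PROVED here, for a presented elliptic curve `P = (L, W)` (`EllPoint`), with `L′ := L̄^{ker ρ̄₃ ∩ ker ρ̄₅}`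
the fixed field of the (open) joint kernel of the mod-`3` and mod-`5` representations:

* `EllPoint.exists_torsion15Field` — an intermediate field `L′` of `L̄/L`, finite Galois over `L`, with
  `Gal(L̄/L′) ≤ ker ρ̄_{E,3}`, `Gal(L̄/L′) ≤ ker ρ̄_{E,5}` and `[L′:L] ∣ 23040` (the tree's
  `finrank_dvd_of_ker_inf_ker_le_fixingSubgroup`, seat abc-iut-S5: `#GL₂(𝔽₃)·#GL₂(𝔽₅) = 48·480`);
* `EllPoint.isSemistable_map_of_fixingSubgroup_le` — for ANY intermediate number field `L′ ⊆ L̄` fixed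
  by `ker ρ̄₃ ∩ ker ρ̄₅`, the base change `W ⊗_L L′` is semistable at every finite place of `L′`
  (Raynaud / [IUTchIV] Prop. 1.8 (v): the tree's `isSemistable_of_forall_smul_geomTorsion_eq_of_ne`,
  seat abc-iut-S5, fed by the cross-closure transport
  `forall_smul_geomTorsion_map_eq_of_fixingSubgroup_le`).

(`NumberField L′` for such `L′` is `NumberField.of_module_finite L L′`, a `Prop`.)  Proof-only; no
definitions.
-/

noncomputable section

open scoped Classical
open WeierstrassCurve Literature.NumberTheory.GaloisRepresentations

namespace Literature.NumberTheory.DiophantineGeometry.GenEll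

namespace EllPoint

/-- **`L′ = L(E[15])`**: an intermediate field of `L̄/L`, finite over `L` of degree dividing
`23040 = #GL₂(𝔽₃)·#GL₂(𝔽₅)`, whose absolute Galois group (inside `Γ_L`) acts trivially on `E[3]` and
`E[5]`. [cite: MochizukiGenEll2010, Thm 3.8 p.20] -/
theorem exists_torsion15Field (P : EllPoint) :
    ∃ L' : IntermediateField P.F (AlgebraicClosure P.F), FiniteDimensional P.F L' ∧ IsGalois P.F L' ∧
      L'.fixingSubgroup ≤ (P.W.galoisRepTorsion ((3 : ℕ) : ℤ)).ker ∧
      L'.fixingSubgroup ≤ (P.W.galoisRepTorsion ((5 : ℕ) : ℤ)).ker ∧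
      Module.finrank P.F L' ∣ 23040 := by
  haveI h3 : Fact (Nat.Prime 3) := ⟨Nat.prime_three⟩
  haveI h5 : Fact (Nat.Prime 5) := ⟨Nat.prime_five⟩
  set H : Subgroup (Field.absoluteGaloisGroup P.F) :=
    (P.W.galoisRepTorsion ((3 : ℕ) : ℤ)).ker ⊓ (P.W.galoisRepTorsion ((5 : ℕ) : ℤ)).ker with hH
  have hopen3 : IsOpen (((P.W.galoisRepTorsion ((3 : ℕ) : ℤ)).ker :
      Subgroup (Field.absoluteGaloisGroup P.F)) : Set (Field.absoluteGaloisGroup P.F)) :=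
    P.W.isOpen_ker_galoisRepTorsion_holds (n := ((3 : ℕ) : ℤ)) (by norm_num)
  have hopen5 : IsOpen (((P.W.galoisRepTorsion ((5 : ℕ) : ℤ)).ker :
      Subgroup (Field.absoluteGaloisGroup P.F)) : Set (Field.absoluteGaloisGroup P.F)) :=
    P.W.isOpen_ker_galoisRepTorsion_holds (n := ((5 : ℕ) : ℤ)) (by norm_num)
  have hopen : IsOpen (H : Set (Field.absoluteGaloisGroup P.F)) := by
    rw [hH, Subgroup.coe_inf]; exact hopen3.inter hopen5
  have hfix : (IntermediateField.fixedField H :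
      IntermediateField P.F (AlgebraicClosure P.F)).fixingSubgroup = H :=
    fixingSubgroup_fixedField_of_isOpen H hopen
  have hgal : IsGalois P.F (IntermediateField.fixedField H :
      IntermediateField P.F (AlgebraicClosure P.F)) := by
    rw [← InfiniteGalois.normal_iff_isGalois, hfix, hH]
    refine ⟨fun x hx g => ⟨?_, ?_⟩⟩
    · exact (P.W.galoisRepTorsion ((3 : ℕ) : ℤ)).normal_ker.conj_mem x hx.1 g
    · exact (P.W.galoisRepTorsion ((5 : ℕ) : ℤ)).normal_ker.conj_mem x hx.2 g
  refine ⟨IntermediateField.fixedField H, finiteDimensional_fixedField_of_isOpen H hopen, hgal,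
    ?_, ?_, ?_⟩
  · rw [fixingSubgroup_fixedField_of_isOpen H hopen]; exact inf_le_left
  · rw [fixingSubgroup_fixedField_of_isOpen H hopen]; exact inf_le_right
  · have h := P.W.finrank_dvd_of_ker_inf_ker_le_fixingSubgroup (p := 3) 5
      (IntermediateField.fixedField H) (by rw [fixingSubgroup_fixedField_of_isOpen H hopen])
    norm_num at h
    exact h

/-- **`E ⊗_L L′` is semistable for `L′ ⊇ L(E[3], E[5])`** ([IUTchIV] Prop. 1.8 (v) / Raynaud: rational
`3`- and `5`-torsion forces semistable reduction everywhere; the tree's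
`isSemistable_of_forall_smul_geomTorsion_eq_of_ne` over `L′`, with the `3`- and `5`-torsion of the
base change Galois-fixed over `L̄′` by `forall_smul_geomTorsion_map_eq_of_fixingSubgroup_le`).
[cite: MochizukiGenEll2010, Thm 3.8 p.20] -/
theorem isSemistable_map_of_fixingSubgroup_le (P : EllPoint)
    (L' : IntermediateField P.F (AlgebraicClosure P.F)) [NumberField L']
    (h3 : L'.fixingSubgroup ≤ (P.W.galoisRepTorsion ((3 : ℕ) : ℤ)).ker)
    (h5 : L'.fixingSubgroup ≤ (P.W.galoisRepTorsion ((5 : ℕ) : ℤ)).ker) :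
    (P.W.map (algebraMap P.F L')).IsSemistable (NumberField.RingOfIntegers L') :=
  (P.W.map (algebraMap P.F L')).isSemistable_of_forall_smul_geomTorsion_eq_of_ne Nat.prime_three
    Nat.prime_five le_rfl (by norm_num) (by norm_num)
    (P.forall_smul_geomTorsion_map_eq_of_fixingSubgroup_le L' 3 h3)
    (P.forall_smul_geomTorsion_map_eq_of_fixingSubgroup_le L' 5 h5)

/-- The `EllPoint` form: the base-changed presentation `(L′, W ⊗_L L′)` is semistable
(`EllPoint.IsSemistable`). [cite: MochizukiGenEll2010, Thm 3.8 p.20] -/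
theorem isSemistable_mk_map_of_fixingSubgroup_le (P : EllPoint)
    (L' : IntermediateField P.F (AlgebraicClosure P.F)) [NumberField L']
    (h3 : L'.fixingSubgroup ≤ (P.W.galoisRepTorsion ((3 : ℕ) : ℤ)).ker)
    (h5 : L'.fixingSubgroup ≤ (P.W.galoisRepTorsion ((5 : ℕ) : ℤ)).ker) :
    (EllPoint.mk L' (P.W.map (algebraMap P.F L'))).IsSemistable :=
  P.isSemistable_map_of_fixingSubgroup_le L' h3 h5

end EllPoint

end Literature.NumberTheory.DiophantineGeometry.GenEll

end
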